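import Summits.BirchSwinnertonDyer.BirchSwinnertonDyer.Theses.LeadingTerm
import Summits.BirchSwinnertonDyer.BirchSwinnertonDyer.Theses.Squeeze
import Summits.BirchSwinnertonDyer.BirchSwinnertonDyer.Theses.HigherGrossZagier
import Summits.BirchSwinnertonDyer.BirchSwinnertonDyer.Theses.PadicCornerSqueeze
import Summits.BirchSwinnertonDyer.BirchSwinnertonDyer.Theses.PlecticLegs
import Literature.NumberTheory.EllipticCurves.LFunctionSmulProofs
import Literature.NumberTheory.EllipticCurves.BSDInvariantsProofs
import HarnessLib

/-!
# BirchSwinnertonDyer — crux `SqueezeUBR2` (stmt-BirchSwinnertonDyer-0145): the strategist's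
# decomposition `SelmerCapAtOnePrime ∧ RankLeOne(GZK) ⟹ SqueezeUBR2`

Crux (`Summit.BirchSwinnertonDyer.BirchSwinnertonDyer.Theses.LeadingTerm.SqueezeUBR2`, byte-identical
with `…Theses.Squeeze.SqueezeUB` and `…Theses.HigherGrossZagier.SqueezeUB`): **no excess rank**,
`rank_ℤ E(ℚ) ≤ ord_{s=1} L(E,s)` for every elliptic `E/ℚ`.

This file is the PROVED IMPLICATION of a typed split of the crux into two EXISTING items of the
portfolio (crux-strategist protocol (b), unit `cstrat-stmt-BirchSwinnertonDyer-0145-s2`):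

* `Sub₁ = PadicCornerSqueeze.SelmerCapAtOnePrime` (stmt-BirchSwinnertonDyer-19215, registered
  skeleton `Cruxes/SelmerCapAtOnePrime/Lines/birth.lean`): every globally minimal elliptic `W` with
  `2 ≤ r_an` has ONE prime `p` with `corank_{ℤ_p} Sel_{p^∞}(E/ℚ) ≤ r_an` — the open core;
* `Sub₂ = PlecticLegs.RankLeOne` (stmt-BirchSwinnertonDyer-17525): `r_an ≤ 1 ⇒ r_an = rank` — a
  THEOREM in print (Gross–Zagier 1986, Kolyvagin 1990 with a non-vanishing quadratic twist
  (Bump–Friedberg–Hoffstein 1990 / Murty–Murty 1991); Kato 2004 Thm 14.2 also covers `r_an = 0`).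

Glue (`squeezeUBR2_of_subs`): for `r_an(W) ≤ 1` use `Sub₂`; otherwise pass to a global minimal
model `C • W` (`hasGlobalMinimalModel_rat_holds`), take the prime of `Sub₁`, bound
`rank ≤ corank Sel_{p^∞}` by the Kummer sequence / corank identity
(`selmerCorank_eq_mordellWeilRank_add_holds`, Greenberg LNM 1716 §1) and transport back along `C`
(`mordellWeilRank_variableChange_holds`, `analyticRank_smul` — route-independent Literature lemmas). No modularity, no Kato, no Ш-finiteness, no heights are used: the
whole open content of the crux sits in `Sub₁`, its whole known content in `Sub₂`.
-/

set_option linter.dupNamespace false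

namespace Summit.BirchSwinnertonDyer.BirchSwinnertonDyer.Theorems

open WeierstrassCurve
open Summit.BirchSwinnertonDyer.BirchSwinnertonDyer.Theses.PadicCornerSqueeze (SelmerCapAtOnePrime)
open Summit.BirchSwinnertonDyer.BirchSwinnertonDyer.Theses.PlecticLegs (RankLeOne)

/-- **Kummer step.** If at ONE prime `p` the `ℤ_p`-corank of `Sel_{p^∞}(E/ℚ)` is at most the
analytic rank, then there is no excess rank: `rank_ℤ E(ℚ) ≤ corank Sel_{p^∞}` by the exact
sequence `0 → E(ℚ) ⊗ ℚ_p/ℤ_p → Sel_{p^∞} → Ш[p^∞] → 0` (corank identity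
`selmerCorank_eq_mordellWeilRank_add_holds`). [cite: Greenberg1999LNM, §1 pp. 54–57] -/
theorem mordellWeilRank_le_analyticRank_of_selmerCorank_le (W : WeierstrassCurve ℚ) [W.IsElliptic]
    (p : ℕ) [Fact p.Prime] (h : W.selmerCorank p ≤ W.analyticRank) :
    W.mordellWeilRank ≤ W.analyticRank := by
  have hid := W.selmerCorank_eq_mordellWeilRank_add_holds p
  omega

/-- **The split glue `Sub₁ → Sub₂ → SqueezeUBR2`.** `SelmerCapAtOnePrime` (stmt-19215: one prime
with `corank Sel_{p^∞} ≤ r_an` whenever `2 ≤ r_an`, on global minimal models) and `RankLeOne`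
(stmt-17525: `r_an ≤ 1 ⇒ r_an = rank`, Gross–Zagier–Kolyvagin) imply no excess rank for every
elliptic `E/ℚ`: case `r_an ≤ 1` by `RankLeOne`; case `2 ≤ r_an` on a global minimal model by the
Kummer step at the prime of `SelmerCapAtOnePrime`, transported back by the Literature lemmas
`mordellWeilRank_variableChange_holds` (AEC III.3.1(b)) and `analyticRank_smul` (AEC App. C §16).
[folklore] -/
theorem squeezeUBR2_of_subs :
    SelmerCapAtOnePrime → RankLeOne →
      Summit.BirchSwinnertonDyer.BirchSwinnertonDyer.Theses.LeadingTerm.SqueezeUBR2 := by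
  intro hCap hGZK W _
  by_cases h1 : W.analyticRank ≤ 1
  · exact (hGZK W h1).symm.le
  · obtain ⟨C, hC⟩ := WeierstrassCurve.hasGlobalMinimalModel_rat_holds W
    have hMW : (C • W).mordellWeilRank = W.mordellWeilRank :=
      WeierstrassCurve.mordellWeilRank_variableChange_holds W C
    have hAn : (C • W).analyticRank = W.analyticRank := WeierstrassCurve.analyticRank_smul W C
    have h2 : 2 ≤ (C • W).analyticRank := by
      rw [hAn]; omega
    obtain ⟨p, hp, hcap⟩ := hCap (C • W) h2
    have hmin : (C • W).mordellWeilRank ≤ (C • W).analyticRank :=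
      mordellWeilRank_le_analyticRank_of_selmerCorank_le (C • W) p hcap
    rw [hMW, hAn] at hmin
    exact hmin

/-- `squeezeUBR2_of_subs` under the route-Squeeze name of the crux (stmt-0145 / stmt-0496 share
the statement byte-for-byte). [folklore] -/
theorem squeezeUB_of_selmerCapAtOnePrime_of_rankLeOne (hCap : SelmerCapAtOnePrime)
    (hGZK : RankLeOne) : Summit.BirchSwinnertonDyer.BirchSwinnertonDyer.Theses.Squeeze.SqueezeUB :=
  squeezeUBR2_of_subs hCap hGZK

/-- `squeezeUBR2_of_subs` under the route-HigherGrossZagier name of the crux. [folklore] -/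
theorem higherGZ_squeezeUB_of_selmerCapAtOnePrime_of_rankLeOne (hCap : SelmerCapAtOnePrime)
    (hGZK : RankLeOne) :
    Summit.BirchSwinnertonDyer.BirchSwinnertonDyer.Theses.HigherGrossZagier.SqueezeUB :=
  squeezeUBR2_of_subs hCap hGZK

/-- **Where the open content went (converse bookkeeping).** Granting no excess rank, the child
`SelmerCapAtOnePrime` is EQUIVALENT to "some prime has `corank_{ℤ_p} Ш(E/ℚ)[p^∞] ≤ r_an − rank`"
on global minimal models with `2 ≤ r_an` — so its surplus over the crux is exactly a one-prime
smallness of `Ш[p^∞]`, implied by finiteness of `Ш(E)[p^∞]` at a single prime. [folklore] -/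
theorem selmerCapAtOnePrime_iff_shaCorank_of_squeezeUBR2
    (hUB : Summit.BirchSwinnertonDyer.BirchSwinnertonDyer.Theses.LeadingTerm.SqueezeUBR2) :
    SelmerCapAtOnePrime ↔
      ∀ (W : WeierstrassCurve ℚ) [W.IsElliptic] [W.IsGloballyMinimal], 2 ≤ W.analyticRank →
        ∃ (p : ℕ) (_ : Fact p.Prime), W.shaCorank p ≤ W.analyticRank - W.mordellWeilRank := by
  constructor
  · intro hCap W _ _ h2
    obtain ⟨p, hp, hcap⟩ := hCap W h2
    refine ⟨p, hp, ?_⟩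
    have hid := W.selmerCorank_eq_mordellWeilRank_add_holds p
    have hub := hUB W
    omega
  · intro hSha W _ _ h2
    obtain ⟨p, hp, hsha⟩ := hSha W h2
    refine ⟨p, hp, ?_⟩
    have hid := W.selmerCorank_eq_mordellWeilRank_add_holds p
    have hub := hUB W
    omega

end Summit.BirchSwinnertonDyer.BirchSwinnertonDyer.Theorems
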